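import Literature.Barriers.Schanuel.NesterenkoModularScopeProp51Proofs
import Mathlib.Algebra.BigOperators.NatAntidiagonal
import Mathlib.Data.Nat.Factorial.Basic
import HarnessLib

/-!
# Nesterenko's multiplicity estimate (LNM 1752 Ch. 10) for the Ramanujan triple — framework-free preliminaries

`Literature/Barriers/Schanuel/NesterenkoModularScopeCh10Prelim.lean` — proofs only (no definitions,
no named facts, nothing asserted). Preliminaries for the discharge of the named fact
`Literature.Barriers.Schanuel.NesterenkoPhilippon2001_ch10_thm_1_1_ramanujan`
(`NesterenkoModularScopeMultiplicity.lean`: Yu. V. Nesterenko in Nesterenko–Philippon (eds.),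
LNM 1752 (2001), Ch. 10, Theorem 1.1 for the system (45) = Theorem 1.3, the multiplicity estimate
`ord_{z=0} A(z, P, Q, R) ≤ c (deg_z A + 1)(deg_x A + 1)³`), which — through
`ch3_thm_2_3_of_ch10_thm_1_1_ramanujan` (`NesterenkoModularScopeProp51Proofs.lean`, the
`D`-property being PROVED there: `NesterenkoPhilippon2001_ch10_prop_5_1_holds`) — is the named fact
`NesterenkoPhilippon2001_ch3_thm_2_3` on which `nesterenko1996_thm_1_1` (Nesterenko 1996, Ch. 3
Thm 1.1) rests (`NesterenkoModularScopeAssembly.lean`, `NesterenkoModularScopeCh8Assembly.lean`).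

## The printed proof of Ch. 10 Thm 1.1 and its inputs (pp. 150–162)

* §2 (p. 154): Thm 1.1 ⇐ Thm 2.1 (the same statement written `log |A(z, f̄)| ≥ −c₁(deg_z A + 1)
  (deg_x A + 1)^m` for the absolute value `|α| = e^{−ord_{z=0} α}` of `K = ℂ(z)`) ⇐ **Thm 2.2**: for
  every unmixed homogeneous ideal `I ⊂ K[x₀, …, x_m]`, `dim I = r − 1 < m`,
  `log |I(ω̄)| ≥ −τ^{mr}(h(I)(deg I)^{r/(m+1−r)} + (deg I)^{m/(m+1−r)})`, `ω̄ = (1, f₁(z), …, f_m(z))`;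
  the deduction 2.1 ⇐ 2.2 is Prop. 4.8 of Ch. 3 applied to `I = (P)`, `P = x₀^{deg_x A} A(x/x₀)`.
  Here `deg I`, `h(I)`, `|I(ω̄)|`, `‖P‖_ω̄`, `ρ` are the invariants of Ch. 3 §4 (Definitions 4.1–4.6,
  (20)) for the field `K = ℂ(z)` with the set of absolute values of Ch. 3 Example 1 (all
  non-archimedean, `𝓜_∞ = ∅`: every error term of Props. 4.7, 4.8, 4.11, 4.13 and Cor. 4.9, 4.10
  "can be omitted").
* §3: Lemma 3.1 (`χ_𝔭(μ, ν) ≤ γ₁((μ+1)ν^{r−1} deg 𝔭 + ν^r h(𝔭))`, [Nes3] with `γ₁ = 6^{m−1}`, or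
  Ch. 9 with `γ₁ = m`), Lemma 3.2 / Cor. 3.3 (a polynomial of bidegree `(μ, ν)` in `𝔭` by counting
  dimensions), **Lemma 3.4** (a prime `𝔭` with `log|𝔭(ω̄)| < −h(𝔭) − c m deg 𝔭` contains `x₀ ∉ 𝔭`
  and NO non-zero `T`-stable prime `𝔮 ⊂ 𝔭`; via Prop. 4.13 + Cor. 4.9 of Ch. 3 and the
  `D`-property), Lemma 3.5 ([Nes6, Lemma 4]: `deg J ≤ deg I deg_x Q`,
  `h(J) ≤ h(I) deg_x Q + deg I deg_z Q` for `(I, Q) ⊂ J` unmixed, `dim J = dim I − 1`), and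
  **Prop. 3.6** (p. 157, proof pp. 157–161: the auxiliary polynomial `B ∉ 𝔭`, `‖B‖_ω̄ ≤ ρ`, of controlled
  bidegree, found among the `T`-iterates `T^j E_i` of a chain `E_0 = E, E_1, …` built with the
  constants `a_j = λ^{2^{j+2}−4}, b_j = λ^{2^{j+1}−1}, c_j = λ^{2^{j+1}−2}`; the key step (p. 159) is the purely differential-algebraic lemma proved below as
  `NesterenkoCh10.apply_mem_of_forall_pow_mul_mem`).
* §4 (pp. 161–162): the induction on `r` (minimal counterexample; Prop. 4.7 of Ch. 3 to pass to a
  prime component; Prop. 3.6; Prop. 4.11 of Ch. 3; the case `r = 1` by the last clause of 4.11).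

So the discharge needs the Ch. 3 §4 toolkit over `K = ℂ(z)` (the tree's `Nesterenko.*` toolkit,
`NesterenkoElimination*.lean`, is the case `K = ℚ`, archimedean `|·|`), Lemma 3.1 and Lemma 3.5;
none of this is in the tree yet. What IS in the tree for the Ramanujan system: the operator `D`
(`ramanujanD`), identity (41) `(DE)(z, P, Q, R) = θ E(z, P, Q, R)` (`ramanujanComposite_ramanujanD`),
the `D`-property with `c = 2` (`hasRamanujanDProperty_two`), Mahler's theorem
(`Mahler1969_ramanujan_algIndep_holds`), and `ch10_thm_1_1_ramanujan_of_general`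
(`NesterenkoModularScopeMultiplicityGeneralProofs.lean`).

## What is proved here

* `NesterenkoCh10.dvd_iterate_apply_pow_sub` — for a derivation `D` of a commutative ring,
  `G^{a+1} ∣ Dᵏ(G^{a+k}) − (a+k)!/a! · G^a (DG)^k`; hence `Dᵏ(Gˡ) ∈ (G)` for `k < l` and
  `Dˡ(Gˡ) ≡ l! (DG)ˡ (mod G)` (`iterate_apply_pow_mem_span_of_lt`, `iterate_apply_pow_self_sub_mem_span`).
* `NesterenkoCh10.apply_mem_of_forall_pow_mul_mem` — **the step of Prop. 3.6, p. 159**: if `𝔮` is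
  prime, `l! ∉ 𝔮`, `Dˡ(𝔞) ⊂ 𝔮`, `H ∉ 𝔮` and `Gˡ H ∈ 𝔞` for all `G ∈ 𝔮`, then `D𝔮 ⊂ 𝔮`
  ("`T^l(G^l H) ∈ 𝔮` … implies `(TG)^l H ∈ 𝔮` … we have `TG ∈ 𝔮`. Thus `T𝔮 ⊂ 𝔮`").
* `NesterenkoCh10.iterate_apply_mem_of_span` — `Dᵏ(𝔞) ⊂ 𝔮` for all `k ≤ l` as soon as this holds
  on a set of generators of `𝔞` (used on p. 159 with `𝔞 = 𝔞_n = (E_0, …, E_n)`).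
* `order_ramanujanComposite_le_order_ramanujanD` (+ `…_iterate`) — by (41),
  `ord (DᵏA)(z, P, Q, R) ≥ ord A(z, P, Q, R)` ((67) on p. 161 in the sharper form valid for (45),
  where `A₀ = 12z` and `θ = z d/dz` does not lower orders).
* `not_isRamanujanDStable_of_forall_le_order` — **Lemma 3.4 in its order form**: if every element of
  an ideal `𝔭` has order `> c` along `(z, P, Q, R)` and the `D`-property holds with constant `c`,
  then no non-zero prime `𝔮 ≤ 𝔭` is `D`-stable (the printed Lemma 3.4 first derives this order
  hypothesis from `log|𝔭(ω̄)| < −h(𝔭) − c m deg 𝔭` by Prop. 4.13 and Cor. 4.9 of Ch. 3).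

## References

* [NesterenkoPhilippon2001] Yu. V. Nesterenko, P. Philippon (eds.), *Introduction to Algebraic
  Independence Theory*, LNM 1752, Springer 2001, Ch. 10 (Yu. V. Nesterenko), §§1–4, pp. 149–161:
  Thm 1.1, (41), Def. 1.2, Thm 2.1, Thm 2.2, Lemmas 3.1–3.5, Prop. 3.6, §4.
* [Nesterenko1996] Yu. V. Nesterenko, *Modular functions and transcendence questions*,
  Sb. Math. 187 (1996) 1319–1348, Thm 3.
-/

noncomputable section

open Finset

namespace Literature.Barriers.Schanuel

/-! ### Iterated derivations, powers and prime ideals -/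

namespace NesterenkoCh10

variable {R A : Type*} [CommSemiring R] [CommRing A] [Algebra R A] (D : Derivation R A A)

/-- Leibniz rule for the iterates of a derivation:
`Dⁿ(fg) = Σ_{i+j=n} (n choose i) Dⁱf Dʲg`. [folklore] -/
private theorem iterate_apply_mul (f g : A) : ∀ n : ℕ,
    D^[n] (f * g) = ∑ p ∈ antidiagonal n, n.choose p.1 • (D^[p.1] f * D^[p.2] g) := by
  intro n
  induction n with
  | zero => simp
  | succ n ih =>
    have h1 : ∑ q ∈ antidiagonal (n + 1), n.choose q.1 • (D^[q.1] f * D^[q.2] g) =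
        ∑ p ∈ antidiagonal n, n.choose p.1 • (D^[p.1] f * D^[p.2 + 1] g) := by
      rw [Finset.Nat.sum_antidiagonal_succ']
      simp
    have h2 : ∑ q ∈ antidiagonal (n + 1), n.choose q.1 • (D^[q.1] f * D^[q.2] g) =
        f * D^[n + 1] g +
          ∑ p ∈ antidiagonal n, n.choose (p.1 + 1) • (D^[p.1 + 1] f * D^[p.2] g) := by
      rw [Finset.Nat.sum_antidiagonal_succ]
      simp
    have h4 : ∀ p : ℕ × ℕ, D (n.choose p.1 • (D^[p.1] f * D^[p.2] g)) =
        n.choose p.1 • (D^[p.1 + 1] f * D^[p.2] g) + n.choose p.1 • (D^[p.1] f * D^[p.2 + 1] g) := by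
      intro p
      rw [map_nsmul, Derivation.leibniz, smul_eq_mul, smul_eq_mul, Function.iterate_succ_apply',
        Function.iterate_succ_apply', ← smul_add]
      congr 1
      ring
    calc D^[n + 1] (f * g)
        = D (∑ p ∈ antidiagonal n, n.choose p.1 • (D^[p.1] f * D^[p.2] g)) := by
          rw [Function.iterate_succ_apply', ih]
      _ = ∑ p ∈ antidiagonal n, n.choose p.1 • (D^[p.1 + 1] f * D^[p.2] g) +
            ∑ p ∈ antidiagonal n, n.choose p.1 • (D^[p.1] f * D^[p.2 + 1] g) := by
          rw [map_sum]
          simp_rw [h4]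
          rw [Finset.sum_add_distrib]
      _ = ∑ p ∈ antidiagonal n, n.choose p.1 • (D^[p.1 + 1] f * D^[p.2] g) +
            (f * D^[n + 1] g +
              ∑ p ∈ antidiagonal n, n.choose (p.1 + 1) • (D^[p.1 + 1] f * D^[p.2] g)) := by
          rw [h1.symm.trans h2]
      _ = f * D^[n + 1] g +
            ∑ p ∈ antidiagonal n, (n.choose p.1 + n.choose (p.1 + 1)) •
              (D^[p.1 + 1] f * D^[p.2] g) := by
          simp_rw [add_smul, Finset.sum_add_distrib]
          abel
      _ = ∑ q ∈ antidiagonal (n + 1), (n + 1).choose q.1 • (D^[q.1] f * D^[q.2] g) := by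
          rw [Finset.Nat.sum_antidiagonal_succ]
          simp only [Nat.choose_zero_right, one_smul, Function.iterate_zero, id_eq,
            Nat.choose_succ_succ']

/-- `D` kills natural-number constants, so `D(n·y) = n·Dy` in product form. [folklore] -/
private theorem apply_natCast_mul (n : ℕ) (y : A) : D ((n : A) * y) = (n : A) * D y := by
  rw [Derivation.leibniz, Derivation.map_natCast, smul_zero, add_zero, smul_eq_mul]

/-- `D(x^{n+1}) = (n+1) xⁿ Dx` in product form. [folklore] -/
private theorem apply_pow_succ (x : A) (n : ℕ) :
    D (x ^ (n + 1)) = ((n + 1 : ℕ) : A) * x ^ n * D x := by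
  rw [Derivation.leibniz_pow, Nat.add_sub_cancel, smul_eq_mul, nsmul_eq_mul]
  ring

/-- Iterates of `D` are additive. [folklore] -/
private theorem iterate_map_add (x y : A) : ∀ k : ℕ, D^[k] (x + y) = D^[k] x + D^[k] y := by
  intro k
  induction k with
  | zero => rfl
  | succ k ih => rw [Function.iterate_succ_apply', ih, map_add, Function.iterate_succ_apply',
      Function.iterate_succ_apply']

/-- **Iterated derivatives of a power.** For a derivation `D` of a commutative ring, `G ∈ A` and
`a, k ∈ ℕ`: `G^{a+1}` divides `Dᵏ(G^{a+k}) − ((a+k)!/a!) · G^a (DG)^k` — the terms of the Leibniz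
expansion in which some factor `G` is differentiated twice keep an undifferentiated factor `G`.
[folklore] -/
theorem dvd_iterate_apply_pow_sub (G : A) (k : ℕ) : ∀ a : ℕ,
    G ^ (a + 1) ∣ D^[k] (G ^ (a + k)) - (((a + k).descFactorial k : ℕ) : A) * (G ^ a * D G ^ k) := by
  induction k with
  | zero =>
    intro a
    simp
  | succ k ih =>
    intro a
    obtain ⟨W, hW⟩ := ih (a + 1)
    have e1 : a + 1 + k = a + (k + 1) := by ring
    rw [e1] at hW
    have hW' : D^[k] (G ^ (a + (k + 1))) =
        (((a + (k + 1)).descFactorial k : ℕ) : A) * (G ^ (a + 1) * D G ^ k) + G ^ (a + 1 + 1) * W := by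
      rw [← hW]; ring
    have hdesc : (a + (k + 1)).descFactorial (k + 1) = (a + 1) * (a + (k + 1)).descFactorial k := by
      rw [Nat.descFactorial_succ]
      congr 1
      omega
    -- differentiate `hW'`
    have hstep : D^[k + 1] (G ^ (a + (k + 1))) =
        (((a + (k + 1)).descFactorial k : ℕ) : A) *
            ((((a + 1 : ℕ) : A) * G ^ a * D G) * D G ^ k + G ^ (a + 1) * D (D G ^ k)) +
          ((((a + 1 + 1 : ℕ) : A) * G ^ (a + 1) * D G) * W + G ^ (a + 1 + 1) * D W) := by
      rw [Function.iterate_succ_apply', hW', map_add, apply_natCast_mul, Derivation.leibniz,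
        Derivation.leibniz (D := D) (G ^ (a + 1 + 1)), apply_pow_succ, apply_pow_succ]
      simp only [smul_eq_mul]
      ring
    refine ⟨(((a + (k + 1)).descFactorial k : ℕ) : A) * D (D G ^ k) +
        (((a + 1 + 1 : ℕ) : A) * D G) * W + G * D W, ?_⟩
    rw [hstep, hdesc]
    push_cast
    ring

/-- For `k < l`, `Dᵏ(Gˡ)` is a multiple of `G`. [folklore] -/
theorem iterate_apply_pow_mem_span_of_lt (G : A) {k l : ℕ} (hkl : k < l) :
    D^[k] (G ^ l) ∈ Ideal.span {G} := by
  obtain ⟨a, rfl⟩ : ∃ a, l = (a + 1) + k := ⟨l - k - 1, by omega⟩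
  obtain ⟨W, hW⟩ := dvd_iterate_apply_pow_sub D G k (a + 1)
  have e : D^[k] (G ^ (a + 1 + k)) =
      (((a + 1 + k).descFactorial k : ℕ) : A) * (G ^ (a + 1) * D G ^ k) + G ^ (a + 1 + 1) * W := by
    rw [← hW]; ring
  rw [e]
  exact (Ideal.span {G}).add_mem
    (Ideal.mem_span_singleton.mpr
      (Dvd.intro ((((a + 1 + k).descFactorial k : ℕ) : A) * G ^ a * D G ^ k) (by ring)))
    (Ideal.mem_span_singleton.mpr (Dvd.intro (G ^ (a + 1) * W) (by ring)))

/-- `Dˡ(Gˡ) ≡ l! (DG)ˡ (mod G)`. [folklore] -/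
theorem iterate_apply_pow_self_sub_mem_span (G : A) (l : ℕ) :
    D^[l] (G ^ l) - ((l.factorial : ℕ) : A) * D G ^ l ∈ Ideal.span {G} := by
  obtain ⟨W, hW⟩ := dvd_iterate_apply_pow_sub D G l 0
  rw [Ideal.mem_span_singleton]
  simp only [zero_add, pow_zero, one_mul, pow_one, Nat.descFactorial_self] at hW
  exact ⟨W, hW⟩

/-- If `Dᵏg ∈ 𝔮` for all `k ≤ l` and all `g` in a generating set `S` of the ideal `𝔞`, then
`Dᵏa ∈ 𝔮` for all `k ≤ l` and all `a ∈ 𝔞` (Leibniz). Used on p. 159 of LNM 1752 Ch. 10 with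
`𝔞 = 𝔞_n = (E_0, …, E_n)`. [cite: NesterenkoPhilippon2001, Ch. 10 proof of Prop. 3.6 (p. 159)] -/
theorem iterate_apply_mem_of_span {S : Set A} {𝔮 : Ideal A} {l : ℕ}
    (hS : ∀ g ∈ S, ∀ k ≤ l, D^[k] g ∈ 𝔮) :
    ∀ a ∈ Ideal.span S, ∀ k ≤ l, D^[k] a ∈ 𝔮 := by
  intro a ha
  refine Submodule.span_induction (p := fun a _ => ∀ k ≤ l, D^[k] a ∈ 𝔮) ?_ ?_ ?_ ?_ ha
  · intro g hg k hk
    exact hS g hg k hk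
  · intro k _
    rw [Function.iterate_fixed (map_zero D)]
    exact 𝔮.zero_mem
  · intro x y _ _ hx hy k hk
    rw [iterate_map_add]
    exact 𝔮.add_mem (hx k hk) (hy k hk)
  · intro r x _ hx k hk
    rw [smul_eq_mul, iterate_apply_mul]
    refine 𝔮.sum_mem fun p hp => ?_
    rw [HasAntidiagonal.mem_antidiagonal] at hp
    exact Submodule.smul_of_tower_mem _ _ (𝔮.mul_mem_left _ (hx p.2 (by omega)))

/-- **LNM 1752 Ch. 10, proof of Prop. 3.6, p. 159 (the key differential-algebraic step).** Let `D`
be a derivation of a commutative ring `A`, `𝔮` a prime ideal with `l! ∉ 𝔮`, `𝔞` an ideal with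
`Dˡ(𝔞) ⊂ 𝔮`, and `H ∉ 𝔮` such that `Gˡ H ∈ 𝔞` for every `G ∈ 𝔮` (in the book: `𝔮` an isolated
prime of `𝔞 = 𝔞_n` with exponent `l`, and all `T^j E_i ∈ 𝔮`, `j ≤ l`). Then `D𝔮 ⊂ 𝔮`: indeed
`Dˡ(Gˡ H) ≡ l! (DG)ˡ H (mod 𝔮)` by the Leibniz rule, since every other term keeps a factor `G`.
[cite: NesterenkoPhilippon2001, Ch. 10 proof of Prop. 3.6 (p. 159)] -/
theorem apply_mem_of_forall_pow_mul_mem {𝔮 𝔞 : Ideal A} (h𝔮 : 𝔮.IsPrime) {l : ℕ}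
    (hfac : ((l.factorial : ℕ) : A) ∉ 𝔮) (h𝔞 : ∀ a ∈ 𝔞, D^[l] a ∈ 𝔮) {H : A} (hH : H ∉ 𝔮)
    (hGH : ∀ G ∈ 𝔮, G ^ l * H ∈ 𝔞) {G : A} (hG : G ∈ 𝔮) : D G ∈ 𝔮 := by
  have hspan : Ideal.span {G} ≤ 𝔮 := (Ideal.span_singleton_le_iff_mem _).mpr hG
  have h1 : D^[l] (G ^ l * H) ∈ 𝔮 := h𝔞 _ (hGH G hG)
  rw [iterate_apply_mul, Finset.Nat.sum_antidiagonal_eq_sum_range_succ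
    (fun i j => l.choose i • (D^[i] (G ^ l) * D^[j] H)), Finset.sum_range_succ,
    Nat.choose_self, one_smul, Nat.sub_self, Function.iterate_zero, id_eq] at h1
  -- the terms with `i < l` lie in `(G) ⊆ 𝔮`
  have h2 : ∑ i ∈ range l, l.choose i • (D^[i] (G ^ l) * D^[l - i] H) ∈ 𝔮 := by
    refine 𝔮.sum_mem fun i hi => ?_
    rw [mem_range] at hi
    exact Submodule.smul_of_tower_mem _ _
      (𝔮.mul_mem_right _ (hspan (iterate_apply_pow_mem_span_of_lt D G hi)))
  have h3 : D^[l] (G ^ l) * H ∈ 𝔮 := by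
    have := 𝔮.sub_mem h1 h2
    rwa [add_sub_cancel_left] at this
  -- `Dˡ(Gˡ) H ≡ l! (DG)ˡ H`
  have h4 : ((l.factorial : ℕ) : A) * D G ^ l * H ∈ 𝔮 := by
    have h5 : (D^[l] (G ^ l) - ((l.factorial : ℕ) : A) * D G ^ l) * H ∈ 𝔮 :=
      𝔮.mul_mem_right _ (hspan (iterate_apply_pow_self_sub_mem_span D G l))
    have := 𝔮.sub_mem h3 h5
    rwa [sub_mul, sub_sub_cancel] at this
  rcases h𝔮.mem_or_mem h4 with h6 | h6
  · rcases h𝔮.mem_or_mem h6 with h7 | h7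
    · exact absurd h7 hfac
    · exact h𝔮.mem_of_pow_mem l h7
  · exact absurd h6 hH

/-- Over a `ℚ`-algebra the hypothesis `l! ∉ 𝔮` of `apply_mem_of_forall_pow_mul_mem` holds for
every proper ideal. [folklore] -/
theorem natCast_factorial_notMem {B : Type*} [CommRing B] [Algebra ℚ B] {𝔮 : Ideal B}
    (h𝔮 : 𝔮 ≠ ⊤) (l : ℕ) : ((l.factorial : ℕ) : B) ∉ 𝔮 := by
  intro h
  apply h𝔮
  refine Ideal.eq_top_of_isUnit_mem _ h ?_
  have : ((l.factorial : ℕ) : B) = algebraMap ℚ B (l.factorial : ℚ) := by simp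
  rw [this]
  exact (IsUnit.mk0 _ (by exact_mod_cast l.factorial_ne_zero)).map _

end NesterenkoCh10

/-! ### Orders along `(z, P, Q, R)` under `D` -/

/-- `θ = z d/dz` does not lower the order of a power series. [folklore] -/
theorem order_le_order_ramanujanTheta (f : PowerSeries ℂ) : f.order ≤ (ramanujanTheta f).order := by
  refine PowerSeries.le_order _ _ fun i hi => ?_
  rw [coeff_ramanujanTheta, PowerSeries.coeff_of_lt_order i hi, mul_zero]

/-- **(41) ⇒ orders do not drop under `D`**: `ord (DA)(z, P, Q, R) ≥ ord A(z, P, Q, R)` — for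
the system (45) the identity (41) reads `(DE)(z, P, Q, R) = θ E(z, P, Q, R)` with `θ = z d/dz`
(compare (67), p. 161, for a general system). [cite: NesterenkoPhilippon2001, Ch. 10 (41) (p. 150), (67) (p. 161)] -/
theorem order_ramanujanComposite_le_order_ramanujanD (A : MvPolynomial (Fin 4) ℂ) :
    (ramanujanComposite A).order ≤ (ramanujanComposite (ramanujanD A)).order := by
  rw [ramanujanComposite_ramanujanD]
  exact order_le_order_ramanujanTheta _

/-- Iterated form: `ord (DᵏA)(z, P, Q, R) ≥ ord A(z, P, Q, R)`.
[cite: NesterenkoPhilippon2001, Ch. 10 (41) (p. 150)] -/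
theorem order_ramanujanComposite_le_order_ramanujanD_iterate (A : MvPolynomial (Fin 4) ℂ) (k : ℕ) :
    (ramanujanComposite A).order ≤ (ramanujanComposite (ramanujanD^[k] A)).order := by
  induction k with
  | zero => exact le_rfl
  | succ k ih =>
    rw [Function.iterate_succ_apply']
    exact ih.trans (order_ramanujanComposite_le_order_ramanujanD _)

/-- **Lemma 3.4 of LNM 1752 Ch. 10, in its order form, for the Ramanujan system.** If every
element of an ideal `𝔭` of `ℂ[z, x₁, x₂, x₃]` vanishes along `(z, P(z), Q(z), R(z))` to order
`> c`, and `(P, Q, R)` has the `D`-property with constant `c`, then no non-zero prime ideal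
`𝔮 ≤ 𝔭` is stable under `D` (such a `𝔮` would contain `E` with `ord E(z, P, Q, R) ≤ c`). The
printed lemma first derives the order hypothesis from `log|𝔭(ω̄)| < −h(𝔭) − c m deg 𝔭` through
Prop. 4.13 and Cor. 4.9 of Ch. 3. [cite: NesterenkoPhilippon2001, Ch. 10 Lemma 3.4 (p. 156)] -/
theorem not_isRamanujanDStable_of_forall_le_order {c : ℕ} (hD : HasRamanujanDProperty c)
    {𝔭 𝔮 : Ideal (MvPolynomial (Fin 4) ℂ)}
    (h𝔭 : ∀ E ∈ 𝔭, ((c + 1 : ℕ) : ℕ∞) ≤ (ramanujanComposite E).order)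
    (hle : 𝔮 ≤ 𝔭) (h𝔮 : 𝔮.IsPrime) (hne : 𝔮 ≠ ⊥) : ¬ IsRamanujanDStable 𝔮 := by
  intro hst
  obtain ⟨E, hE, hord⟩ := hD 𝔮 h𝔮 hne hst
  have h := (h𝔭 E (hle hE)).trans hord
  exact absurd h (by exact_mod_cast Nat.lt_irrefl _ ∘ fun h => Nat.lt_of_succ_le h)

/-- With the proved `D`-property (`c = 2`, `hasRamanujanDProperty_two`): an ideal all of whose
members vanish to order `≥ 3` along `(z, P, Q, R)` contains no non-zero `D`-stable prime.
[cite: NesterenkoPhilippon2001, Ch. 10 Lemma 3.4 (p. 156) and Prop. 5.1 (p. 162)] -/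
theorem not_isRamanujanDStable_of_forall_three_le_order
    {𝔭 𝔮 : Ideal (MvPolynomial (Fin 4) ℂ)}
    (h𝔭 : ∀ E ∈ 𝔭, (3 : ℕ∞) ≤ (ramanujanComposite E).order)
    (hle : 𝔮 ≤ 𝔭) (h𝔮 : 𝔮.IsPrime) (hne : 𝔮 ≠ ⊥) : ¬ IsRamanujanDStable 𝔮 :=
  not_isRamanujanDStable_of_forall_le_order hasRamanujanDProperty_two
    (fun E hE => by exact_mod_cast h𝔭 E hE) hle h𝔮 hne

end Literature.Barriers.Schanuel

end
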